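import Mathlib.RingTheory.MvPolynomial.Basic
import Mathlib.Algebra.MvPolynomial.Funext
import Literature.Computability.AlgebraicComplexity.ArithCircuit
import Literature.Computability.AlgebraicComplexity.StandardFamilies
import HarnessLib

/-!
# Barrier catalogue `ValiantsHypothesis`: algebraically natural proofs versus succinct hitting
sets (Forbes–Shpilka–Volk 2018; Grochow–Kumar–Saks–Saraf 2017) — a CONDITIONAL barrier

D-0021 barrier entry for the summit `ValiantsHypothesis` (`VP_ℂ ≠ VNP_ℂ`): the algebraic analogue
of Razborov–Rudich. Technique class: *algebraically natural proofs* — lower bounds certified by a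
nonzero "distinguisher" polynomial `D` in the `N` coefficients of an `n`-variate degree-`≤ d`
polynomial that vanishes on the coefficient vectors of all polynomials of small circuit size
(FSV Def. 1: "essentially all known algebraic circuit lower bounds to date", GKSS abstract; rank
methods — partial derivatives, evaluation/coefficient dimension, shifted partials — are of this
form with `D` a minor of the method's matrix, FSV §1.2). The barrier is CONDITIONAL: such proofs
of polynomial constructivity do not exist against `VP` **iff** the coefficient vectors of small
circuits form a hitting set for small circuits in `N` variables ("succinct hitting sets", FSV
Thm. 4 / Cor. 5, GKSS), whose existence is FSV's open Question 6.

**The printed results** (arXiv:1701.05328 = Theory Comput. 14 (2018), checked with `lit read`).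

* Def. 1 (Algebraically Natural Proof). For a set of monomials `M` in `x₁,…,x_n`, `H(M)` their
  span, classes `𝒞 ⊆ H(M)` and `𝒟 ⊆ 𝔽[{c_m}_{m ∈ M}]`: "A polynomial `D ∈ 𝒟` is an (algebraic)
  `𝒟`-natural proof against `𝒞` ... if (1) `D` is a non-zero polynomial. (2) For all `f ∈ 𝒞`, `D`
  vanishes on the coefficient vector of `f`, that is, `D(coeff_M(f)) = 0`."
* Def. 3 (Succinct Hitting Set). "`𝒞` is a `𝒞`-succinct hitting set for `𝒟` if
  `{coeff_M(f) : f ∈ 𝒞}` is a hitting set for `𝒟`. That is, `D ∈ 𝒟` is non-zero iff `D|_𝒞` is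
  non-zero, that is, there is some `f ∈ 𝒞` such that `D(coeff_M(f)) ≠ 0`."
* Thm. 4. "Then there is an algebraic `𝒟`-natural proof against `𝒞` iff `𝒞` is not a `𝒞`-succinct
  hitting set for `𝒟`." Cor. 5: with `M` = monomials of degree `≤ d`, `N = binom(n+d, d)`,
  `𝒞` = `poly(n,d)`-size circuits of degree `≤ d`: "there is an algebraic `poly(N)`-natural proof
  against `𝒞` iff `𝒞` is not a `poly(n,d)`-succinct hitting set for `poly(N)`-size circuits in `N`
  variables"; for `d = poly(n)`, `poly(n) = polylog(N)`.
* Question 6 (Algebraic Natural Proofs Barrier). "Is there a `polylog(N)`-succinct hitting set for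
  circuits of `poly(N)`-size?" (also raised by GKSS, who "observe that if this is true, then many
  proof techniques — including those of the recent advances — cannot be used to separate `VP_{ws}`
  from `VNP`", GKSS §1).
* Thm. 9 (evidence, unconditional, restricted `𝒟`): in the space of multilinear polynomials the
  coefficient vectors of `poly(log s, n)`-size multilinear formulas of a fixed simple shape are a
  succinct hitting set for several restricted classes of `N = 2^n`-variate size-`s` computations
  (sparse polynomials, depth-3 circuits of bounded transcendence degree, commutative roABPs, ...);
  Thm. 10 (roABPs, width `w²`). §1.2: techniques outside the framework — the substitution method
  (separates rank from border rank by constant factors); shifted partials are only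
  `quasipoly(N)`-natural.
* Status of Question 6 (printed): Chatterjee–Kumar–Ramya–Saptharishi–Tengse 2020, Thm. 1.1–1.4:
  UNCONDITIONALLY there are `VP_ℂ`-natural proofs (efficiently computable equations) vanishing on
  all of `VP` (and `VNP`) restricted to polynomials with coefficients in `{-1, 0, 1}` (and over
  constant-size finite fields) — "any such separation of `VP` and `VNP` will have to rely on more
  fine grained information on the equations, and not just their degree and algebraic circuit size"
  (§1.4); Bürgisser 2024, §7.3: "the recent work [KRST22] shows that, without the assumption of
  bounded coefficients, `VNP` does not have equations in `VP` if the permanent is hard (in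
  characteristic zero). The proof does not appear to extend to `VP`. Clearly, more work is required
  to clarify the situation!"

**What this file does.** The framework over a general commutative semiring `F`: Defs. 1 and 3
(`IsNaturalProof`, `IsSuccinctHittingSet`, coefficient vector `coeffVector M f` on a monomial set
`M`; generalised in that `𝒞 ⊆ H(M)` is not required — `coeffVector` projects onto the
`M`-coefficients); Thm. 4 PROVED (`exists_isNaturalProof_iff`). The concrete classes and the
barrier over an INFINITE field `F` (`[Infinite F]`; the summit's `ℂ` is an instance): the sources
work over large fields (FSV §1.2: a product of nonzero polynomials cannot vanish everywhere "over
large enough fields"; hitting sets live in `𝔽^N`), and over a finite field `𝔽_q` the hypothesis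
below is simply FALSE — the `2`-gate distinguisher `c_m^q - c_m` is a nonzero polynomial vanishing
at every point of `𝔽_q^N` — so nothing is claimed there; the
concrete classes of Cor. 5 / Question 6 in the tree's size measure `CplxAlg.complexity`
(fan-in-two circuit size, Bürgisser's `L` up to a factor `≤ 3`): `SmallCircuits F n b` (degree
`≤ n`, size `≤ n^b`; the regime `d = n = poly(n)`) and `Distinguishers F n a` (size and degree
`≤ N^a` in the `N = binom(2n, n)` coefficient variables); the hypothesis of the barrier
`SuccinctHittingSetsForVP F` (Question 6 answered "yes": every `a` is hit by some `b`); the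
technique-class target `NaturalProofAgainstVP F a` (for every size exponent `b`, infinitely often
a level-`a` natural proof against size-`n^b` circuits that is nonzero at `per_n` — what an
algebraically natural proof of `per ∉ VP`, hence of `ValiantsHypothesis`, must supply); and the
conditional no-go PROVED: `SuccinctHittingSetsForVP F → ∀ a, ¬ NaturalProofAgainstVP F a`
(`not_naturalProofAgainstVP`). Nothing unproved is asserted; the open hypothesis is a `def`.

**Audit 2026-08-16 (barrier NARROWED, appended below).** FSV Def. 1 lets the simple class `𝒞` be
ANY subset of `H(M)`; the catalogued no-go blocks only distinguishers vanishing on the WHOLE of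
`SmallCircuits F n b` (every degree-`≤ n` polynomial of size `≤ n^b`, coefficients unrestricted in
the infinite field). A distinguisher vanishing only on a structural SLICE `SmallCircuits F n b ∩ P n`
that contains the target (`P` = coefficients in `{-1,0,1}` — the permanent's; multilinear;
homogeneous; …) is an FSV-natural proof against `𝒞 = VP ∩ P`, is a sound lower-bound method for
targets in `P` (`exists_not_mem_smallCircuits_of_rel`), and is blocked only by the `P`-RELATIVE
hitting-set hypothesis `SuccinctHittingSetsForVPRel F P`, which Question 6 does not imply
(kernel-checked separation at the level of Thm. 4: `isSuccinctHittingSet_and_isNaturalProofRel`)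
and which for `P` = bounded integer coefficients is FALSE in print: `VP_ℂ`-constructible equations
for `VP` (even `VNP`) with coefficients in `{-1,0,1}` exist unconditionally (CKRST 2020, Thm. 1.1 and
1.3; "it is conceivable that we might be able to prove a super-polynomial lower bound ... for the
permanent polynomial via an algebraically natural proof constructible in VP", §1.4), while for
`P` = multilinear it is open and FSV's universal-circuit machinery does not apply ("No such
universal circuits are known for efficient multilinear computation", FSV §3). The corrected entry
is `AlgebraicNaturalProofsNarrow` (proved, `algebraicNaturalProofsNarrow_holds`; it specialises
to the original at `P = ⊤`, `algebraicNaturalProofs_of_narrow`). Context for the weight of the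
hypothesis: Question 6 answered "yes" would itself imply `VP ≠ VNP` or a strong uniform `TC⁰`
lower bound under GRH (Chatterjee–Tengse 2023, Thm. "Hardness from Succinct Hitting Sets"), and
for `VNP` in place of `VP` it follows from `2^{m^ε}`-hardness of the permanent (KRST 2022, Thm.
"Conditional Hardness of Equations for VNP").

## References

* [ForbesShpilkaVolk2018] M. A. Forbes, A. Shpilka, B. L. Volk, Theory Comput. 14 (2018) 18:1–45
  (STOC 2017; arXiv:1701.05328), Def. 1, Question 2, Def. 3, Thm. 4, Cor. 5, Question 6,
  Meta-Conj. 8, Thm. 9–10, Cor. 11, §1.2.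
* [GrochowKumarSaksSaraf2017] J. A. Grochow, M. Kumar, M. Saks, S. Saraf, arXiv:1701.01717
  (ECCC TR17-009), abstract and §1–1.1.
* [ChatterjeeKumarRamyaSaptharishiTengse2020] P. Chatterjee, M. Kumar, C. Ramya, R. Saptharishi,
  A. Tengse, FOCS 2020, 870–880 (arXiv:2004.14147), Thm. 1.1–1.4, §1.4.
* [Burgisser2024Completeness] P. Bürgisser, *Completeness classes in algebraic complexity theory*,
  arXiv:2406.06217, §7.3.
* [KumarRamyaSaptharishiTengse2022] M. Kumar, C. Ramya, R. Saptharishi, A. Tengse, *If VNP is hard,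
  then so are equations for it*, STACS 2022, LIPIcs 219, 44 (arXiv:2012.07056), Thm. "Conditional
  Hardness of Equations for VNP", §1.2 and §4.
* [ChatterjeeTengse2023] P. Chatterjee, A. Tengse, *Lower bounds from succinct hitting sets*,
  arXiv:2309.07612 (ECCC TR23), Thm. "Hardness from Succinct Hitting Sets", Def. 21–23.
-/

noncomputable section

namespace Literature.Barriers.ValiantsHypothesis

open Literature.Computability.AlgebraicComplexity MvPolynomial

/-! ### The framework (FSV Def. 1, Def. 3, Thm. 4) -/

section Framework

variable {F : Type*} [CommSemiring F] {σ : Type*}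

/-- The coefficient vector `coeff_M(f) = (c_m)_{m ∈ M}` of `f` on a set of monomials `M`
(exponent vectors). [cite: ForbesShpilkaVolk2018, Def. 1] -/
def coeffVector (M : Set (σ →₀ ℕ)) (f : MvPolynomial σ F) : M → F :=
  fun m => coeff (m : σ →₀ ℕ) f

/-- Unfolding: the `m`-th entry of the coefficient vector is the coefficient of `x^m`.
[cite: ForbesShpilkaVolk2018, Def. 1] -/
@[simp] theorem coeffVector_apply (M : Set (σ →₀ ℕ)) (f : MvPolynomial σ F) (m : M) :
    coeffVector M f m = coeff (m : σ →₀ ℕ) f := rfl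

/-- **FSV Def. 1 (Algebraically Natural Proof).** `D` is a `𝒟`-natural proof against `𝒞` (with
respect to the monomial set `M`; distinguishers are polynomials in the `|M|` coefficient variables
`c_m`): `D ∈ 𝒟`, `D ≠ 0`, and `D(coeff_M(f)) = 0` for all `f ∈ 𝒞`. Generalised: print has
`𝒞 ⊆ H(M)`; here `𝒞` is any set of polynomials and `coeffVector M` projects onto the
`M`-coefficients (harmless; the concrete classes below lie in `H(M)`).
[cite: ForbesShpilkaVolk2018, Def. 1] -/
def IsNaturalProof (M : Set (σ →₀ ℕ)) (𝒞 : Set (MvPolynomial σ F)) (𝒟 : Set (MvPolynomial M F))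
    (D : MvPolynomial M F) : Prop :=
  D ∈ 𝒟 ∧ D ≠ 0 ∧ ∀ f ∈ 𝒞, eval (coeffVector M f) D = 0

/-- **FSV Def. 3 (Succinct Hitting Set).** `𝒞` is a (`𝒞`-succinct) hitting set for `𝒟`: every
nonzero `D ∈ 𝒟` is nonzero at the coefficient vector of some `f ∈ 𝒞` (generalised as in
`IsNaturalProof`: `𝒞 ⊆ H(M)` not required). [cite: ForbesShpilkaVolk2018, Def. 3] -/
def IsSuccinctHittingSet (M : Set (σ →₀ ℕ)) (𝒞 : Set (MvPolynomial σ F))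
    (𝒟 : Set (MvPolynomial M F)) : Prop :=
  ∀ D ∈ 𝒟, D ≠ 0 → ∃ f ∈ 𝒞, eval (coeffVector M f) D ≠ 0

/-- **FSV Thm. 4**: "there is an algebraic `𝒟`-natural proof against `𝒞` iff `𝒞` is not a
`𝒞`-succinct hitting set for `𝒟`" ("follows immediately from the definitions"; GKSS §1.1).
[cite: ForbesShpilkaVolk2018, Thm. 4] -/
theorem exists_isNaturalProof_iff (M : Set (σ →₀ ℕ)) (𝒞 : Set (MvPolynomial σ F))
    (𝒟 : Set (MvPolynomial M F)) :
    (∃ D, IsNaturalProof M 𝒞 𝒟 D) ↔ ¬ IsSuccinctHittingSet M 𝒞 𝒟 := by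
  simp only [IsNaturalProof, IsSuccinctHittingSet, not_forall, not_exists, not_and, not_not]
  constructor
  · rintro ⟨D, hD, hD0, hvan⟩
    exact ⟨D, hD, hD0, fun f hf => hvan f hf⟩
  · rintro ⟨D, hD, hD0, hvan⟩
    exact ⟨D, hD, hD0, fun f hf => hvan f hf⟩

/-- Monotonicity: a hitting set for `𝒟` is one for every subclass, and stays one after enlarging
`𝒞`. [folklore] -/
theorem IsSuccinctHittingSet.mono {M : Set (σ →₀ ℕ)} {𝒞 𝒞' : Set (MvPolynomial σ F)}
    {𝒟 𝒟' : Set (MvPolynomial M F)} (h : IsSuccinctHittingSet M 𝒞 𝒟) (h𝒞 : 𝒞 ⊆ 𝒞')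
    (h𝒟 : 𝒟' ⊆ 𝒟) : IsSuccinctHittingSet M 𝒞' 𝒟' :=
  fun D hD hD0 => let ⟨f, hf, hne⟩ := h D (h𝒟 hD) hD0; ⟨f, h𝒞 hf, hne⟩

end Framework

/-! ### The concrete classes of Cor. 5 / Question 6 (regime `d = n`) -/

section Classes

variable (F : Type*) [Field F]

/-- The monomial set of FSV's space `𝔽[x₁,…,x_n]^{≤ d}` with `d = n`: exponent vectors of degree
`≤ n` in `n` variables; `N = |M| = binom(2n, n)` coefficient variables.
[cite: ForbesShpilkaVolk2018, §1.2 (the space of total degree ≤ d)] -/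
def degLEMonomials (n : ℕ) : Set (Fin n →₀ ℕ) :=
  {m | m.degree ≤ n}

/-- **The "simple" class `𝒞`**: `n`-variate polynomials over `F` of degree `≤ n` and fan-in-two
circuit size `CplxAlg.complexity f ≤ n ^ b` (FSV Cor. 5's "`poly(n,d)`-size circuits of total
degree at most `d`", `d = n`, one exponent `b` at a time). [cite: ForbesShpilkaVolk2018, Cor. 5] -/
def SmallCircuits (n b : ℕ) : Set (MvPolynomial (Fin n) F) :=
  {f | f.totalDegree ≤ n ∧ complexity f ≤ n ^ b}

/-- **The distinguisher class `𝒟`**: polynomials in the `N = binom(2n, n)` coefficient variables of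
fan-in-two circuit size and degree at most `N ^ a` ("`poly(N)`-size circuits in `N` variables",
FSV Cor. 5 / Cor. 15 "`poly(N)`-size `poly(N)`-degree"; GKSS: "computable by an algebraic circuit
whose size is polynomial in the number of coefficients"). [cite: ForbesShpilkaVolk2018, Cor. 5 and Question 6] -/
def Distinguishers (n a : ℕ) : Set (MvPolynomial (degLEMonomials n) F) :=
  {D | complexity D ≤ (Nat.choose (2 * n) n) ^ a ∧ D.totalDegree ≤ (Nat.choose (2 * n) n) ^ a}

end Classes

section Hypothesis

/-- **The hypothesis of the barrier — FSV Question 6 answered "yes" (GKSS: "succinct hitting sets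
exist for `VP`")**: for every distinguisher exponent `a` there are a succinctness exponent `b` and
`n₀` such that for all `n ≥ n₀` the coefficient vectors of degree-`≤ n` polynomials of circuit size
`≤ n^b` hit every nonzero distinguisher of size and degree `≤ N^a`, `N = binom(2n, n)`
("a `polylog(N)`-succinct hitting set for circuits of `poly(N)`-size"). Stated for an INFINITE
field only (`[Infinite F]`, the sources' "large enough fields"): over `𝔽_q` it is false, the
nonzero `2`-gate distinguisher `c_m^q - c_m` vanishing identically on `𝔽_q^N`. OPEN as printed
over infinite fields (Question 6; Meta-Conj. 8 and Thm. 9 establish succinct hitting sets only for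
restricted `𝒟`). [cite: ForbesShpilkaVolk2018, Question 6] -/
def SuccinctHittingSetsForVP (F : Type*) [Field F] [Infinite F] : Prop :=
  ∀ a : ℕ, ∃ b n₀ : ℕ, ∀ n : ℕ, n₀ ≤ n →
    IsSuccinctHittingSet (degLEMonomials n) (SmallCircuits F n b) (Distinguishers F n a)

/-- Monotonicity of the simple class in the size exponent (for `n ≥ 1`): `n^b ≤ n^{b'}` when
`b ≤ b'`. [folklore] -/
theorem smallCircuits_mono (F : Type*) [Field F] {n b b' : ℕ} (h : b ≤ b') (hn : 1 ≤ n) :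
    SmallCircuits F n b ⊆ SmallCircuits F n b' :=
  fun _ hf => ⟨hf.1, hf.2.trans (Nat.pow_le_pow_right hn h)⟩

/-- **Technique class: an algebraically natural proof (of constructivity level `a`) that a target
family `h = (h_n)` is not in `VP`.** To show `h ∉ VP` one must beat every polynomial size bound
`n^b`; naturally, this means: for every `b`, for infinitely many `n`, a distinguisher
`D ∈ Distinguishers F n a` vanishing on (the coefficient vectors of) all of `SmallCircuits F n b`
("useful against size `n^b`") and nonzero at `h_n`. With `h_n = per_n` (in `n` of its variables,
or any re-indexing) this is what a natural proof of `ValiantsHypothesis` via the permanent must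
deliver (FSV §1.2: usefulness, constructivity, largeness). [cite: ForbesShpilkaVolk2018, Def. 1 and Question 2] -/
def NaturalProofAgainstVP (F : Type*) [Field F] (a : ℕ) (h : ∀ n, MvPolynomial (Fin n) F) : Prop :=
  ∀ b : ℕ, ∀ n₀ : ℕ, ∃ n : ℕ, n₀ ≤ n ∧ ∃ D : MvPolynomial (degLEMonomials n) F,
    IsNaturalProof (degLEMonomials n) (SmallCircuits F n b) (Distinguishers F n a) D ∧
      eval (coeffVector (degLEMonomials n) (h n)) D ≠ 0

end Hypothesis

/-! ### The conditional no-go (proved) -/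

section NoGo

variable {F : Type*} [Field F] [Infinite F]

/-- Under the hypothesis, beyond the matching succinctness level there is NO natural proof at all
(FSV Thm. 4 applied to Question 6's classes). [cite: ForbesShpilkaVolk2018, Thm. 4 and Cor. 5] -/
theorem not_exists_isNaturalProof_of_succinct (hyp : SuccinctHittingSetsForVP F) (a : ℕ) :
    ∃ b n₀ : ℕ, ∀ n : ℕ, n₀ ≤ n →
      ¬ ∃ D, IsNaturalProof (degLEMonomials n) (SmallCircuits F n b) (Distinguishers F n a) D := by
  obtain ⟨b, n₀, h⟩ := hyp a
  refine ⟨b, n₀, fun n hn => ?_⟩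
  rw [exists_isNaturalProof_iff, not_not]
  exact h n hn

/-- **The algebraic natural proofs barrier (conditional form, FSV Cor. 5 / Question 6; GKSS):** if
succinct hitting sets for `VP` exist, then for every constructivity level `a` there is no
algebraically natural proof of level `a` that any target family — in particular the permanent —
lies outside `VP`: `¬ NaturalProofAgainstVP F a h`. [cite: ForbesShpilkaVolk2018, Cor. 5 and Question 6] -/
theorem not_naturalProofAgainstVP (hyp : SuccinctHittingSetsForVP F) (a : ℕ)
    (h : ∀ n, MvPolynomial (Fin n) F) : ¬ NaturalProofAgainstVP F a h := by
  intro hnat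
  obtain ⟨b, n₀, hb⟩ := not_exists_isNaturalProof_of_succinct hyp a
  obtain ⟨n, hn, D, hD, -⟩ := hnat b n₀
  exact hb n hn ⟨D, hD⟩

omit [Infinite F] in
/-- Conversely (the "iff" of Thm. 4 at the level of Question 6): if the hypothesis FAILS at level
`a`, then for every `b` there are infinitely many `n` carrying a level-`a` natural proof against
size-`n^b` circuits (some nonzero small `D` vanishing on all of `SmallCircuits F n b`) — an
algebraically natural "`VP` has nontrivial equations of polynomial complexity" statement, though
not by itself a lower bound for a specified family. [cite: ForbesShpilkaVolk2018, Thm. 4 and Cor. 5] -/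
theorem exists_isNaturalProof_of_not_succinct {a : ℕ}
    (hyp : ¬ ∃ b n₀ : ℕ, ∀ n : ℕ, n₀ ≤ n →
      IsSuccinctHittingSet (degLEMonomials n) (SmallCircuits F n b) (Distinguishers F n a))
    (b n₀ : ℕ) :
    ∃ n : ℕ, n₀ ≤ n ∧
      ∃ D, IsNaturalProof (degLEMonomials n) (SmallCircuits F n b) (Distinguishers F n a) D := by
  by_contra hcon
  push Not at hcon
  refine hyp ⟨b, n₀, fun n hn => ?_⟩
  have := hcon n hn
  rw [← not_exists, exists_isNaturalProof_iff, not_not] at this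
  exact this

end NoGo

/-! ### The barrier entry -/

/-- **Algebraic natural proofs barrier for `ValiantsHypothesis` (Forbes–Shpilka–Volk 2018, Thm. 4 /
Cor. 5 / Question 6; Grochow–Kumar–Saks–Saraf 2017), CONDITIONAL:** over an infinite field
`F` (e.g. `ℂ`), if succinct hitting sets for `VP` exist (`SuccinctHittingSetsForVP F`, FSV Question 6) then no
algebraically natural proof of any polynomial constructivity level shows that any family (e.g. the
permanent) is outside `VP`. This `def` is the implication; it is PROVED below
(`algebraicNaturalProofs_holds`, from Thm. 4), so the entire weight of the barrier is the open
hypothesis.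

BARRIER
technique_class: algebraically-natural-proofs, natural-proofs (algebraic analogue of Razborov–Rudich), distinguisher / test-polynomial / equations-for-VP methods, rank methods with polynomial-size minors (partial derivatives, evaluation and coefficient dimension; shifted partials only at quasi-polynomial constructivity)
blocks: conditionally on `SuccinctHittingSetsForVP F` [cite: ForbesShpilkaVolk2018, Question 6]: every `VP`-constructible distinguisher proof that the permanent (or any explicit family) has superpolynomial circuit size — `NaturalProofAgainstVP F a h` for any level `a`, refuted by `not_naturalProofAgainstVP` — hence this style of proof of `ValiantsHypothesis`; "a certain kind of algebraic proof — which covers essentially all known algebraic circuit lower bounds to date — cannot be used to prove lower bounds against `VP` if and only if what we call succinct hitting sets exist for `VP`" [cite: GrochowKumarSaksSaraf2017, abstract]; the equivalence itself is unconditional (`exists_isNaturalProof_iff`) [cite: ForbesShpilkaVolk2018, Thm. 4 and Cor. 5].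
because: a natural proof is a nonzero `D ∈ 𝒟` vanishing on `{coeff_M(f) : f ∈ 𝒞}`, which is verbatim the statement that this set of coefficient vectors fails to be a hitting set for `𝒟` [cite: ForbesShpilkaVolk2018, Thm. 4]; so succinct derandomisation of polynomial identity testing for `poly(N)`-size circuits by coefficient vectors of `polylog(N)`-size circuits (the algebraic stand-in for the pseudorandom functions of Razborov–Rudich) is exactly the non-existence of `poly(N)`-natural proofs against `VP` [cite: ForbesShpilkaVolk2018, Cor. 5 and §1.3]; evidence for the hypothesis: succinct hitting sets from coefficient vectors of `poly(log s, n)`-size multilinear formulas exist unconditionally against sparse polynomials, depth-3 circuits of bounded transcendence degree, commutative roABPs and the other classes of Thm. 9, and width-`w²` roABPs hit width-`w` roABPs [cite: ForbesShpilkaVolk2018, Thm. 9 and Thm. 10].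
evasions_known: techniques outside the framework exist — the substitution method proves tensor-rank bounds above border rank (by constant factors), and any method separating a complexity from its border version is not algebraically natural [cite: ForbesShpilkaVolk2018, §1.2]; against the HYPOTHESIS: unconditionally there ARE `VP`-natural proofs vanishing on all of `VP` (even `VNP`) restricted to polynomials with coefficients in `{-1,0,1}` (and over constant-size finite fields), so a natural proof of `per ∉ VP` "is conceivable" but "will have to rely on more fine grained information on the equations, and not just their degree and algebraic circuit size" [cite: ChatterjeeKumarRamyaSaptharishiTengse2020, Thm. 1.1–1.4 and §1.4]; in the other direction, without bounded coefficients `VNP` has no equations in `VP` if the permanent is hard (characteristic zero), a proof that "does not appear to extend to `VP`" [cite: Burgisser2024Completeness, §7.3].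
scope_caveats: NARROWED 2026-08-16 (barrier audit) — `technique_class`/`blocks` above over-reach: what is blocked is exactly a distinguisher vanishing on the WHOLE class `SmallCircuits F n b` (all degree-`≤ n` polynomials of size `≤ n^b`, coefficients unrestricted in the infinite field); distinguishers vanishing only on a structural slice `SmallCircuits F n b ∩ P n` containing the target (coefficients in `{-1,0,1}` — the permanent's slice —, multilinear, homogeneous, …) are FSV-natural (Def. 1 allows any `𝒞 ⊆ H(M)` [cite: ForbesShpilkaVolk2018, Def. 1]), sound, and NOT blocked by `SuccinctHittingSetsForVP` — see `AlgebraicNaturalProofsNarrow`, the separation `isSuccinctHittingSet_and_isNaturalProofRel`, and for the `{-1,0,1}` slice the unconditional existence of `VP`-constructible equations [cite: ChatterjeeKumarRamyaSaptharishiTengse2020, Thm. 1.1 and §1.4]; the entry assumes an infinite field (`[Infinite F]`; print: "large enough fields" [cite: ForbesShpilkaVolk2018, §1.2]) — over a finite field `𝔽_q` the hypothesis `SuccinctHittingSetsForVP` is false outright (`c_m^q - c_m` is a nonzero `2`-gate distinguisher vanishing on all of `𝔽_q^N`), so the barrier would be vacuous there and is not stated; NOTHING unconditional is claimed against `VP`: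 Question 6 is open ("Clearly, more work is required to clarify the situation!" [cite: Burgisser2024Completeness, §7.3]); the framework proves only BORDER (closure) lower bounds, so it does not cover methods sensitive to the difference between complexity and border complexity [cite: ForbesShpilkaVolk2018, §1.2 and §1.6]; the Lean classes fix the regime `d = n`, distinguisher size AND degree `≤ N^a` with `N = binom(2n,n)`, and the tree's fan-in-two size `CplxAlg.complexity` (constants free) — print allows any `d = poly(n)` and speaks of `poly(N)`-size circuits; `NaturalProofAgainstVP` asks usefulness against size `n^b` for EVERY `b` infinitely often, the minimum a proof of `per ∉ VP` needs, and the no-go does not even use non-vanishing at the target.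
status: theorem (established; conditional statement — the implication is proved here as `algebraicNaturalProofs_holds`, its hypothesis `SuccinctHittingSetsForVP` is FSV's open Question 6) [cite: ForbesShpilkaVolk2018, Thm. 4, Cor. 5, Question 6] -/
def AlgebraicNaturalProofs (F : Type*) [Field F] [Infinite F] : Prop :=
  SuccinctHittingSetsForVP F → ∀ (a : ℕ) (h : ∀ n, MvPolynomial (Fin n) F), ¬ NaturalProofAgainstVP F a h

/-- The barrier implication holds (FSV Thm. 4). [cite: ForbesShpilkaVolk2018, Thm. 4 and Cor. 5] -/
theorem algebraicNaturalProofs_holds (F : Type*) [Field F] [Infinite F] : AlgebraicNaturalProofs F :=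
  fun hyp a h => not_naturalProofAgainstVP hyp a h

/-! ### Audit 2026-08-16: natural proofs RELATIVE to a slice `P` — the narrowed barrier

FSV Def. 1 / Def. 3 / Thm. 4 with the simple class `𝒞` replaced by `𝒞 ∩ P` and non-zeroness of
the distinguisher measured on `P` (FSV §1.2: "to discuss lower bounds for multilinear computation
one must restrict attention to the space" of multilinear polynomials — the distinguisher `c_0`
vanishes on all homogeneous polynomials without proving anything). -/

section Relative

variable {F : Type*} [CommSemiring F] {σ : Type*}

/-- **Relative succinct hitting set** (FSV Def. 3 for the class `𝒞 ∩ P` inside the slice `P`):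
every `D ∈ 𝒟` that is nonzero at some member of `P` is nonzero at some SIMPLE member of `P`.
At `P = Set.univ` this is implied by `IsSuccinctHittingSet` (`IsSuccinctHittingSet.rel_univ`).
[cite: ForbesShpilkaVolk2018, Def. 3] -/
def IsSuccinctHittingSetRel (M : Set (σ →₀ ℕ)) (P 𝒞 : Set (MvPolynomial σ F))
    (𝒟 : Set (MvPolynomial M F)) : Prop :=
  ∀ D ∈ 𝒟, (∃ g ∈ P, eval (coeffVector M g) D ≠ 0) →
    ∃ f ∈ 𝒞, f ∈ P ∧ eval (coeffVector M f) D ≠ 0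

/-- **Relative natural proof** (FSV Def. 1 against the class `𝒞 ∩ P`, non-triviality witnessed
inside `P`): `D ∈ 𝒟` vanishes on every simple member of `P` and is nonzero somewhere on `P`.
[cite: ForbesShpilkaVolk2018, Def. 1] -/
def IsNaturalProofRel (M : Set (σ →₀ ℕ)) (P 𝒞 : Set (MvPolynomial σ F))
    (𝒟 : Set (MvPolynomial M F)) (D : MvPolynomial M F) : Prop :=
  D ∈ 𝒟 ∧ (∃ g ∈ P, eval (coeffVector M g) D ≠ 0) ∧
    ∀ f ∈ 𝒞, f ∈ P → eval (coeffVector M f) D = 0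

/-- **FSV Thm. 4, relative form**: a relative natural proof exists iff `𝒞 ∩ P` is not a relative
succinct hitting set. [cite: ForbesShpilkaVolk2018, Thm. 4] -/
theorem exists_isNaturalProofRel_iff (M : Set (σ →₀ ℕ)) (P 𝒞 : Set (MvPolynomial σ F))
    (𝒟 : Set (MvPolynomial M F)) :
    (∃ D, IsNaturalProofRel M P 𝒞 𝒟 D) ↔ ¬ IsSuccinctHittingSetRel M P 𝒞 𝒟 := by
  simp only [IsNaturalProofRel, IsSuccinctHittingSetRel, not_forall, not_exists, not_and, not_not]
  exact ⟨fun ⟨D, hD, hg, hvan⟩ => ⟨D, hD, hg, fun f hf hfP => hvan f hf hfP⟩,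
    fun ⟨D, hD, hg, hvan⟩ => ⟨D, hD, hg, fun f hf hfP => hvan f hf hfP⟩⟩

/-- The absolute hitting property gives the relative one for the trivial slice `P = univ`.
[folklore] -/
theorem IsSuccinctHittingSet.rel_univ {M : Set (σ →₀ ℕ)} {𝒞 : Set (MvPolynomial σ F)}
    {𝒟 : Set (MvPolynomial M F)} (h : IsSuccinctHittingSet M 𝒞 𝒟) :
    IsSuccinctHittingSetRel M Set.univ 𝒞 𝒟 := by
  rintro D hD ⟨g, -, hg⟩
  have hD0 : D ≠ 0 := by rintro rfl; simp at hg
  obtain ⟨f, hf, hne⟩ := h D hD hD0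
  exact ⟨f, hf, Set.mem_univ f, hne⟩

/-- **Separation (the gap in the catalogued barrier, at the level of FSV Thm. 4).** Over every
infinite field there are `M, 𝒞, P`, a target `h ∈ P ∖ 𝒞` and a distinguisher `D` such that `𝒞` IS
a succinct hitting set for ALL distinguishers (so by Thm. 4 no natural proof against `𝒞` exists)
and yet `D` is a natural proof against `𝒞 ∩ P` certifying `h ∉ 𝒞`. Witness (one variable, `M` =
the monomial `x`, one coefficient `c`): `𝒞 = {c ≠ 1}` hits every nonzero `D(c)`; `P = {c ∈ {0,1}}`
("`0/1` coefficients"), `h = x`, `D = c`. This is the shape of CKRST 2020: `VP ∩ {-1,0,1}`-coefficient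
polynomials HAVE `VP`-constructible equations whatever the answer to FSV Question 6.
[cite: ChatterjeeKumarRamyaSaptharishiTengse2020, Thm. 1.1 and §1.4] -/
theorem isSuccinctHittingSet_and_isNaturalProofRel (F : Type*) [Field F] [Infinite F] :
    ∃ (M : Set (Unit →₀ ℕ)) (P 𝒞 : Set (MvPolynomial Unit F)) (h : MvPolynomial Unit F)
      (D : MvPolynomial M F),
      IsSuccinctHittingSet M 𝒞 Set.univ ∧ h ∈ P ∧ h ∉ 𝒞 ∧
        IsNaturalProofRel M P 𝒞 Set.univ D ∧ eval (coeffVector M h) D ≠ 0 := by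
  classical
  set x : Unit →₀ ℕ := Finsupp.single () 1 with hx
  let m₀ : ({x} : Set (Unit →₀ ℕ)) := ⟨x, Set.mem_singleton x⟩
  have hm : ∀ m : ({x} : Set (Unit →₀ ℕ)), m = m₀ := fun m => Subtype.ext m.2
  have hev : ∀ f : MvPolynomial Unit F,
      eval (coeffVector {x} f) (X m₀ : MvPolynomial ({x} : Set (Unit →₀ ℕ)) F) = coeff x f := by
    intro f; simp [m₀]
  have hXx : coeff x (X () : MvPolynomial Unit F) = 1 := by simp [hx]
  refine ⟨{x}, {f | coeff x f = 0 ∨ coeff x f = 1}, {f | coeff x f ≠ 1}, X (), X m₀,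
    ?_, Or.inr hXx, by simp [hXx], ⟨Set.mem_univ _, ⟨X (), Or.inr hXx, ?_⟩, ?_⟩, ?_⟩
  · intro D _ hD0
    have hE : D * (X m₀ - C 1) ≠ 0 := by
      refine mul_ne_zero hD0 fun h0 => ?_
      have := congrArg (eval fun _ => (0 : F)) h0
      simp at this
    obtain ⟨v, hv⟩ : ∃ v, eval v (D * (X m₀ - C 1)) ≠ 0 := by
      by_contra hcon
      push Not at hcon
      exact hE (MvPolynomial.funext fun v => by simpa using hcon v)
    simp only [map_mul, map_sub, eval_X, eval_C, ne_eq, mul_eq_zero, not_or, sub_eq_zero] at hv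
    refine ⟨monomial x (v m₀), by simpa using hv.2, ?_⟩
    have hcv : coeffVector {x} (monomial x (v m₀) : MvPolynomial Unit F) = v := by
      funext m; rw [hm m]; simp [m₀]
    rw [hcv]; exact hv.1
  · rw [hev, hXx]; exact one_ne_zero
  · rintro f hf (h0 | h1)
    · rw [hev, h0]
    · exact absurd h1 hf
  · rw [hev, hXx]; exact one_ne_zero

end Relative

section RelativeClasses

variable (F : Type*) [Field F]

/-- The slice of polynomials with coefficients in `{-1, 0, 1}` (CKRST's "bounded integer
coefficients"; contains `per_n`, `det_n`, `IMM`). [cite: ChatterjeeKumarRamyaSaptharishiTengse2020, Thm. 1.1] -/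
def signCoeffSlice (n : ℕ) : Set (MvPolynomial (Fin n) F) :=
  {f | ∀ m, coeff m f = 0 ∨ coeff m f = 1 ∨ coeff m f = -1}

/-- The slice of multilinear polynomials (FSV's space `𝔽[x]^{≤1}_{ideg}`, where Thm. 9's evidence
lives and `per_n` lives). [cite: ForbesShpilkaVolk2018, §1.2 and Thm. 9] -/
def multilinearSlice (n : ℕ) : Set (MvPolynomial (Fin n) F) :=
  {f | ∀ m ∈ f.support, ∀ i, m i ≤ 1}

/-- **`P`-relative hypothesis**: for every distinguisher level `a` some size exponent `b` makes
`SmallCircuits F n b ∩ P n` hit, for all large `n`, every level-`a` distinguisher that is nonzero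
somewhere on `P n`. At `P = ⊤` it follows from `SuccinctHittingSetsForVP` (FSV Question 6,
`succinctHittingSetsForVPRel_univ`); for `P = signCoeffSlice` it is FALSE in print (CKRST 2020
Thm. 1.1: `VP_ℂ`-natural proofs against `VP ∩ {-1,0,1}`-coefficients exist for every `b`, not
formalised here); for `P = multilinearSlice` it is open (FSV Thm. 9: only restricted `𝒟`).
[cite: ForbesShpilkaVolk2018, Def. 3 and Question 6] -/
def SuccinctHittingSetsForVPRel [Infinite F] (P : ∀ n, Set (MvPolynomial (Fin n) F)) : Prop :=
  ∀ a : ℕ, ∃ b n₀ : ℕ, ∀ n : ℕ, n₀ ≤ n →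
    IsSuccinctHittingSetRel (degLEMonomials n) (P n) (SmallCircuits F n b) (Distinguishers F n a)

/-- **`P`-relative technique class**: for every `b`, infinitely often, a level-`a` distinguisher
vanishing on the SIMPLE members of the slice `P n` (not necessarily on all of `SmallCircuits F n b`)
and nonzero at the target `h n`. [cite: ForbesShpilkaVolk2018, Def. 1] -/
def NaturalProofAgainstVPRel (P : ∀ n, Set (MvPolynomial (Fin n) F)) (a : ℕ)
    (h : ∀ n, MvPolynomial (Fin n) F) : Prop :=
  ∀ b n₀ : ℕ, ∃ n : ℕ, n₀ ≤ n ∧ ∃ D ∈ Distinguishers F n a,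
    (∀ f ∈ SmallCircuits F n b, f ∈ P n → eval (coeffVector (degLEMonomials n) f) D = 0) ∧
      eval (coeffVector (degLEMonomials n) (h n)) D ≠ 0

variable {F}

/-- **Soundness of the relative method**: a `P`-relative natural proof for a target lying in the
slice shows the target escapes size `n^b` infinitely often, for every `b` — i.e. `h ∉ VP` in the
`d = n` regime. [folklore] -/
theorem exists_not_mem_smallCircuits_of_rel {P : ∀ n, Set (MvPolynomial (Fin n) F)} {a : ℕ}
    {h : ∀ n, MvPolynomial (Fin n) F} (hnat : NaturalProofAgainstVPRel F P a h)
    (hP : ∀ n, h n ∈ P n) (b n₀ : ℕ) : ∃ n, n₀ ≤ n ∧ h n ∉ SmallCircuits F n b := by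
  obtain ⟨n, hn, D, -, hvan, hne⟩ := hnat b n₀
  exact ⟨n, hn, fun hmem => hne (hvan _ hmem (hP n))⟩

/-- An absolute natural proof is a relative one for the trivial slice. [folklore] -/
theorem NaturalProofAgainstVP.rel_univ {a : ℕ} {h : ∀ n, MvPolynomial (Fin n) F}
    (hnat : NaturalProofAgainstVP F a h) : NaturalProofAgainstVPRel F (fun _ => Set.univ) a h := by
  intro b n₀
  obtain ⟨n, hn, D, ⟨hD, -, hvan⟩, hne⟩ := hnat b n₀
  exact ⟨n, hn, D, hD, fun f hf _ => hvan f hf, hne⟩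

/-- Question 6 gives the relative hypothesis for the trivial slice. [folklore] -/
theorem succinctHittingSetsForVPRel_univ [Infinite F] (hyp : SuccinctHittingSetsForVP F) :
    SuccinctHittingSetsForVPRel F (fun _ => Set.univ) := fun a =>
  let ⟨b, n₀, hb⟩ := hyp a; ⟨b, n₀, fun n hn => (hb n hn).rel_univ⟩

/-- **Relative no-go**: the `P`-relative hypothesis blocks `P`-relative natural proofs for targets
in `P`. [cite: ForbesShpilkaVolk2018, Thm. 4] -/
theorem not_naturalProofAgainstVPRel [Infinite F] {P : ∀ n, Set (MvPolynomial (Fin n) F)}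
    (hyp : SuccinctHittingSetsForVPRel F P) (a : ℕ) (h : ∀ n, MvPolynomial (Fin n) F)
    (hP : ∀ n, h n ∈ P n) : ¬ NaturalProofAgainstVPRel F P a h := by
  intro hnat
  obtain ⟨b, n₀, hb⟩ := hyp a
  obtain ⟨n, hn, D, hD, hvan, hne⟩ := hnat b n₀
  obtain ⟨f, hf, hfP, hfne⟩ := hb n hn D hD ⟨h n, hP n, hne⟩
  exact hfne (hvan f hf hfP)

end RelativeClasses

/-- **Algebraic natural proofs barrier, NARROWED (audit 2026-08-16).** For every slice `P`, the
`P`-relative succinct-hitting-set hypothesis blocks `P`-relative natural proofs of `h ∉ VP` for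
targets `h` in `P`; PROVED (`algebraicNaturalProofsNarrow_holds`) and equal to the catalogued
`AlgebraicNaturalProofs` at `P = ⊤` (`algebraicNaturalProofs_of_narrow`).

BARRIER
technique_class: algebraically-natural-proofs RELATIVE TO A SLICE `P` ∋ target — a `poly(N)`-size-and-degree distinguisher vanishing on `{f : deg f ≤ n, size f ≤ n^b} ∩ P n`; `P = ⊤` (vanishing on ALL small circuits, coefficients unrestricted) is the catalogued class and contains the rank methods as used against general circuits
blocks: for each `P` separately, conditionally on `SuccinctHittingSetsForVPRel F P`: `NaturalProofAgainstVPRel F P a h` for `h` in `P` (`not_naturalProofAgainstVPRel`) [cite: ForbesShpilkaVolk2018, Thm. 4]; FSV Question 6 (`SuccinctHittingSetsForVP`) is the case `P = ⊤` ONLY (`succinctHittingSetsForVPRel_univ`) and implies no other case: a class can be a hitting set for every distinguisher while its `0/1`-coefficient members are annihilated by a one-variable distinguisher that certifies a `0/1` target (`isSuccinctHittingSet_and_isNaturalProofRel`) [cite: ChatterjeeKumarRamyaSaptharishiTengse2020, §1.4]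
because: relative Thm. 4 (`exists_isNaturalProofRel_iff`) — a relative natural proof is verbatim the failure of `𝒞 ∩ P` to hit a distinguisher that is nonzero on `P` [cite: ForbesShpilkaVolk2018, Thm. 4]; the hitting polynomial supplied by Question 6 may lie outside `P` (coefficients outside `{-1,0,1}`, non-multilinear), so it says nothing about distinguishers that vanish only on `VP ∩ P` [cite: ChatterjeeKumarRamyaSaptharishiTengse2020, Thm. 1.1 and §1.4]
evasions_known: `P = signCoeffSlice` (the permanent's slice): the relative hypothesis is FALSE — for every `c` there is `{P_{N,c}} ∈ VP_ℂ` vanishing on the coefficient vectors of all `f ∈ VP_ℂ` (even `VNP_ℂ`) of degree `≤ n^c` with coefficients in `{-1,0,1}` and nonzero at some such `h` [cite: ChatterjeeKumarRamyaSaptharishiTengse2020, Thm. 1.1 and Thm. 1.3], so usefulness + constructivity are available unconditionally and the only missing ingredient is non-vanishing at `per_n` (their `P_{N,c}` also kills `VNP ∩ {-1,0,1}`: "any such separation ... will have to rely on more fine grained information on the equations" [cite: ChatterjeeKumarRamyaSaptharishiTengse2020, §1.4 and Remark 24]); `P = multilinearSlice`: open, and the succinct-generator/universal-circuit reduction behind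 Question 6 is unavailable ("No such universal circuits are known for efficient multilinear computation" [cite: ForbesShpilkaVolk2018, §3]); weight of the `P = ⊤` hypothesis itself: under GRH it implies `VP ≠ VNP` or a strong lower bound against uniform constant-depth threshold circuits [cite: ChatterjeeTengse2023, Thm. Hardness from Succinct Hitting Sets], and its `VNP` analogue follows from `2^{m^ε}`-hardness of `per_m` while the proof "does not appear to extend to" `VP` [cite: KumarRamyaSaptharishiTengse2022, Thm. Conditional Hardness of Equations for VNP and §4]
scope_caveats: same regime as the catalogued entry (`d = n`, `N = binom(2n,n)`, distinguisher size AND degree `≤ N^a`, `[Infinite F]`, fan-in-two `complexity`); border caveat unchanged (a relative natural proof still only separates `h` from the Zariski closure of `VP ∩ P`) [cite: ForbesShpilkaVolk2018, §1.7]; the print refutation of the `signCoeffSlice` hypothesis is cited, not formalised; `IsSuccinctHittingSetRel` at `P = ⊤` is implied by, and (with no finiteness hypothesis on `M`) EQUIVALENT to, `IsSuccinctHittingSet` — the implication is proved here (`succinctHittingSetsForVPRel_univ`), the equivalence in `AlgebraicNaturalProofsGenerators.lean` (`isSuccinctHittingSetRel_univ_iff`, `succinctHittingSetsForVPRel_u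niv_iff`)
status: theorem (established; every implication proved here; hypotheses per slice: `⊤` open = FSV Question 6, `signCoeffSlice` refuted in print, `multilinearSlice` open) [cite: ForbesShpilkaVolk2018, Thm. 4 and Question 6] -/
def AlgebraicNaturalProofsNarrow (F : Type*) [Field F] [Infinite F] : Prop :=
  ∀ P : (∀ n, Set (MvPolynomial (Fin n) F)), SuccinctHittingSetsForVPRel F P →
    ∀ (a : ℕ) (h : ∀ n, MvPolynomial (Fin n) F), (∀ n, h n ∈ P n) → ¬ NaturalProofAgainstVPRel F P a h

/-- The narrowed barrier holds (relative FSV Thm. 4). [cite: ForbesShpilkaVolk2018, Thm. 4] -/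
theorem algebraicNaturalProofsNarrow_holds (F : Type*) [Field F] [Infinite F] :
    AlgebraicNaturalProofsNarrow F :=
  fun _ hyp a h hP => not_naturalProofAgainstVPRel hyp a h hP

/-- The narrowed entry specialises to the catalogued one at the trivial slice `P = ⊤`.
[cite: ForbesShpilkaVolk2018, Thm. 4 and Cor. 5] -/
theorem algebraicNaturalProofs_of_narrow (F : Type*) [Field F] [Infinite F]
    (hN : AlgebraicNaturalProofsNarrow F) : AlgebraicNaturalProofs F :=
  fun hyp a h hnat => hN (fun _ => Set.univ) (succinctHittingSetsForVPRel_univ hyp) a h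
    (fun _ => Set.mem_univ _) hnat.rel_univ

end Literature.Barriers.ValiantsHypothesis
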